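import Literature.NumberTheory.Sieve.HeathBrownCubicTypeIICharSum
import Literature.NumberTheory.Sieve.HeathBrownCubicTypeIIOffDiag
import Literature.NumberTheory.Sieve.HeathBrownCubicTypeIIGenerators
import Literature.NumberTheory.Sieve.HeathBrownCubicLatticeCount
import HarnessLib

/-!
# Crux `HeathBrownMorozUniform` (stmt-Parity-19915), line `unit-split-positivity`: stub E4 `stub_classMainCauchy`

Heath-Brown, Acta Math. 186 (2001), §11 p. 68 — `M_V = ∑_α c_α ∑_β F_β W(αβ)` and Cauchy's inequality —
for the CLASS main term `M_V^{cl} = ∑_{(x,y) ∈ box, x ≡ a₀, y ≡ b₀ (d)} Hprim(x,y)` of Heath-Brown–Moroz 2004,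
Prop. 4.2 (ii), (4.6): after the re-indexing `(x, y, β) ↔ (α̂, β̂)` (the tree's bijection
`sum_pairSet_eq_sum_sigmaSet`) the class condition is a condition on `α̂β̂ (mod d)`; for `β̂ ≡ v (mod d)`
it depends on `(α̂, v)` only (`imulVec` is `ℤ`-bilinear), so splitting `β̂` by its `d³` residues `v` and
bounding the `{0,1}`-valued class indicator and `|c_α| ≤ 1` trivially, Cauchy–Schwarz gives
`|M_V^{cl}| ≤ (#Abox)^{1/2} ∑_v S(v)^{1/2}` with the dispersion sum TWISTED by `[β̂ ≡ v (mod d)]`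
(HBM04 p. 23: "we decompose the sum according to the residue classes of `β₁, β₂` modulo `d`").
The final theorem `stub_classMainCauchy` is the registered signature of the merged skeleton
`Cruxes/HeathBrownMorozUniform/Lines/unit_split_positivity.lean` VERBATIM. No unit structure and no
admissibility of the class is needed.

## References

* D. R. Heath-Brown, Acta Math. 186 (2001), §11 p. 68. [cite: HeathBrownActa2001, §11 p. 68]
* D. R. Heath-Brown, B. Z. Moroz, Proc. London Math. Soc. 88 (2004), Prop. 4.2 (ii), (4.6).
  [cite: HeathBrownMoroz2004, Proposition 4.2]
-/

noncomputable section

open Polynomial NumberField Finset Filter Topology Asymptotics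

namespace Summit.Parity.GeneralizedHardyLittlewood.Theorems.GoldbachHeathBrownDispersionHeathBrownMorozUniform

open Literature.NumberTheory.Sieve.CubicSieve Literature.NumberTheory.Sieve.CubicPrimes
open Literature.NumberTheory.LFunctions.CubeRootTwoField
open Literature.NumberTheory.Sieve

variable {X η τ V T : ℝ} {k : ℕ} {m : Fin k → ℕ} {c : Ideal (𝓞 K) → ℝ} {d a₀ b₀ : ℕ}

/-! ### The class of `α̂β̂` depends on `β̂ (mod d)` only -/

/-- `d ∣ β̂ − v` componentwise ⇒ `d ∣ α̂β̂ − α̂v` componentwise (`imulVec a ·` is `ℤ`-linear: it is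
multiplication by `coordElt a` in `ℤ[2^{1/3}]`). [cite: HeathBrownMoroz2004, Proposition 4.2] -/
theorem dvdVec_imulVec_sub {D : ℤ} {a b v : ℤ × ℤ × ℤ} (h : DvdVec D (b - v)) :
    DvdVec D (imulVec a b - imulVec a v) := by
  rw [← intCast_dvd_coordElt_iff] at h ⊢
  rw [coordElt_sub, coordElt_imulVec, coordElt_imulVec, ← mul_sub, ← coordElt_sub]
  exact h.mul_left _

/-- For `β̂ ≡ v (mod d)` the class of `α̂β̂` modulo `d` is that of `α̂v`. [cite: HeathBrownMoroz2004, Proposition 4.2] -/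
theorem cls_imulVec_iff {d : ℕ} {a b v : ℤ × ℤ × ℤ} (h : DvdVec (d : ℤ) (b - v)) (a₀ b₀ : ℕ) :
    ((imulVec a b).1 ≡ a₀ [ZMOD d] ∧ (imulVec a b).2.1 ≡ b₀ [ZMOD d]) ↔
      ((imulVec a v).1 ≡ a₀ [ZMOD d] ∧ (imulVec a v).2.1 ≡ b₀ [ZMOD d]) := by
  obtain ⟨h1, h2, -⟩ := dvdVec_imulVec_sub (a := a) h
  simp only [Prod.fst_sub, Prod.snd_sub] at h1 h2
  have e1 : (imulVec a v).1 ≡ (imulVec a b).1 [ZMOD d] := Int.modEq_iff_dvd.mpr h1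
  have e2 : (imulVec a v).2.1 ≡ (imulVec a b).2.1 [ZMOD d] := Int.modEq_iff_dvd.mpr h2
  constructor
  · rintro ⟨g1, g2⟩; exact ⟨e1.trans g1, e2.trans g2⟩
  · rintro ⟨g1, g2⟩; exact ⟨e1.symm.trans g1, e2.symm.trans g2⟩

/-! ### `M_V^{cl} = ∑_α c_α ∑_β [W(αβ)][cls(α̂β̂)] F_β` -/

open scoped Classical in
/-- **The class main term over generators**: `M_V^{cl} = ∑_{α̂ ∈ Abox} c_α ∑_{β̂ ∈ Bbox} [W(α̂β̂) ∧ cls(α̂β̂)] F_β`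
(the tree's re-indexing bijection with the class indicator carried along: `α̂β̂ = (x, y, 0)`).
[cite: HeathBrownActa2001, §11 p. 68] -/
theorem classMain_eq_sum_cA (hX : 0 < X) (hη1 : η ≤ 1) (hT : 0 < T) (hTV : T ^ 3 = V) :
    ∑ xy ∈ (box X η).filter (fun xy => xy.1 ≡ a₀ [MOD d] ∧ xy.2 ≡ b₀ [MOD d]), Hprim X τ m V T c xy =
      ∑ a ∈ Abox X T, cA c a * ∑ b ∈ Bbox T,
        (if Wab X η a b ∧ ((imulVec a b).1 ≡ a₀ [ZMOD d] ∧ (imulVec a b).2.1 ≡ b₀ [ZMOD d]) then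
          Fb X τ m V T b else 0) := by
  classical
  set Φ : (_ : ℕ × ℕ) × 𝓞 K → ℝ := fun s =>
    if IsPrimitiveVec (coordVec s.2) ∧ IsPrimitiveVec (coordVec (quo (pairElt s.1) s.2)) then
      c (Ideal.span {quo (pairElt s.1) s.2}) * gCut X τ m V (Ideal.span {s.2}) else 0 with hΦ
  set Ψ : (_ : ℕ × ℕ) × 𝓞 K → ℝ := fun s =>
    if s.1.1 ≡ a₀ [MOD d] ∧ s.1.2 ≡ b₀ [MOD d] then Φ s else 0 with hΨ
  have hL : ∑ xy ∈ (box X η).filter (fun xy => xy.1 ≡ a₀ [MOD d] ∧ xy.2 ≡ b₀ [MOD d]), Hprim X τ m V T c xy =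
      ∑ s ∈ sigmaSet X η V T, Ψ s := by
    have e1 : ∑ s ∈ sigmaSet X η V T, Ψ s = ∑ xy ∈ box X η, ∑ β ∈ winDivs T (pairElt xy), Ψ ⟨xy, β⟩ := by
      rw [sigmaSet_eq_filter, sum_filter_of_ne, sum_sigma]
      rintro ⟨xy, β⟩ _ hne
      by_contra hnot
      apply hne
      simp only [hΨ, hΦ]
      rw [gCut_eq_zero_of_not hnot]
      simp
    rw [e1, sum_filter]
    refine sum_congr rfl fun xy _ => ?_
    by_cases hcl : xy.1 ≡ a₀ [MOD d] ∧ xy.2 ≡ b₀ [MOD d]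
    · rw [if_pos hcl, Hprim]
      refine sum_congr rfl fun β _ => ?_
      simp only [hΨ, hΦ]
      rw [if_pos hcl]
    · rw [if_neg hcl]
      symm
      refine sum_eq_zero fun β _ => ?_
      simp only [hΨ]
      rw [if_neg hcl]
  set G : (ℤ × ℤ × ℤ) × (ℤ × ℤ × ℤ) → ℝ := fun ab =>
    cA c ab.1 * (if Wab X η ab.1 ab.2 ∧ ((imulVec ab.1 ab.2).1 ≡ a₀ [ZMOD d] ∧ (imulVec ab.1 ab.2).2.1 ≡ b₀ [ZMOD d])
      then Fb X τ m V T ab.2 else 0) with hG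
  have hR : ∑ a ∈ Abox X T, cA c a * ∑ b ∈ Bbox T,
        (if Wab X η a b ∧ ((imulVec a b).1 ≡ a₀ [ZMOD d] ∧ (imulVec a b).2.1 ≡ b₀ [ZMOD d]) then
          Fb X τ m V T b else 0) = ∑ ab ∈ pairSet X η V T, G ab := by
    rw [pairSet, sum_filter_of_ne, sum_product]
    · simp only [hG, mul_sum]
    · rintro ⟨a, b⟩ _ hne
      simp only [hG] at hne
      have hW : Wab X η a b ∧ ((imulVec a b).1 ≡ a₀ [ZMOD d] ∧ (imulVec a b).2.1 ≡ b₀ [ZMOD d]) := by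
        by_contra h; rw [if_neg h, mul_zero] at hne; exact hne rfl
      rw [if_pos hW] at hne
      have hF : Fb X τ m V T b ≠ 0 := fun h => by rw [h, mul_zero] at hne; exact hne rfl
      obtain ⟨hw, -, hN⟩ := support_of_Fb_ne_zero hF
      exact ⟨hW.1, hw, hN⟩
  rw [hL, hR, sum_pairSet_eq_sum_sigmaSet hX hη1 hT hTV]
  refine sum_congr rfl fun s hs => ?_
  have hmem := phiMap_mem_pairSet hX hη1 hT hTV hs
  rw [mem_pairSet_iff] at hmem
  obtain ⟨-, hW, hw, -, -⟩ := hmem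
  have hs' := hs
  rw [mem_sigmaSet_iff hX.le hT] at hs'
  obtain ⟨-, -, hdvd, -, -⟩ := hs'
  have hmul := imulVec_phiMap hdvd
  have hcls : ((imulVec (phiMap s).1 (phiMap s).2).1 ≡ a₀ [ZMOD d] ∧
      (imulVec (phiMap s).1 (phiMap s).2).2.1 ≡ b₀ [ZMOD d]) ↔ (s.1.1 ≡ a₀ [MOD d] ∧ s.1.2 ≡ b₀ [MOD d]) := by
    rw [hmul]
    simp only
    rw [Int.natCast_modEq_iff, Int.natCast_modEq_iff]
  simp only [hG, hΨ, hΦ, cA, Fb]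
  have ha : coordElt (phiMap s).1 = quo (pairElt s.1) s.2 := by rw [phiMap]; exact coordElt_coordVec _
  have hb : coordElt (phiMap s).2 = s.2 := by rw [phiMap]; exact coordElt_coordVec _
  have ha' : (phiMap s).1 = coordVec (quo (pairElt s.1) s.2) := rfl
  have hb' : (phiMap s).2 = coordVec s.2 := rfl
  by_cases hcl : s.1.1 ≡ a₀ [MOD d] ∧ s.1.2 ≡ b₀ [MOD d]
  · have hcond : Wab X η (phiMap s).1 (phiMap s).2 ∧ ((imulVec (phiMap s).1 (phiMap s).2).1 ≡ a₀ [ZMOD d] ∧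
        (imulVec (phiMap s).1 (phiMap s).2).2.1 ≡ b₀ [ZMOD d]) := ⟨hW, hcls.mpr hcl⟩
    rw [if_pos hcl, if_pos hcond, ha, hb, hb']
    rw [hb] at hw
    by_cases h1 : IsPrimitiveVec (coordVec (quo (pairElt s.1) s.2)) <;>
      by_cases h2 : IsPrimitiveVec (coordVec s.2) <;> simp [h1, h2, hw, ha']
  · have hcond : ¬ (Wab X η (phiMap s).1 (phiMap s).2 ∧ ((imulVec (phiMap s).1 (phiMap s).2).1 ≡ a₀ [ZMOD d] ∧
        (imulVec (phiMap s).1 (phiMap s).2).2.1 ≡ b₀ [ZMOD d])) := fun h => hcl (hcls.mp h.2)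
    rw [if_neg hcl, if_neg hcond, mul_zero]

/-! ### The residue split of `β̂` and Cauchy's inequality -/

open scoped Classical in
/-- **The residue split**: for fixed `α̂`,
`∑_β̂ [W ∧ cls(α̂β̂)] F_β = ∑_{v mod d} [cls(α̂v)] ∑_β̂ [W][β̂ ≡ v (d)] F_β`. [cite: HeathBrownMoroz2004, Proposition 4.2] -/
theorem inner_cls_eq_sum_resVecs (hd : 0 < d) (a : ℤ × ℤ × ℤ) :
    ∑ b ∈ Bbox T, (if Wab X η a b ∧ ((imulVec a b).1 ≡ a₀ [ZMOD d] ∧ (imulVec a b).2.1 ≡ b₀ [ZMOD d]) then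
        Fb X τ m V T b else 0) =
      ∑ v ∈ resVecs d, (if ((imulVec a v).1 ≡ a₀ [ZMOD d] ∧ (imulVec a v).2.1 ≡ b₀ [ZMOD d]) then (1 : ℝ) else 0) *
        ∑ b ∈ Bbox T, (if Wab X η a b then (if DvdVec (d : ℤ) (b - v) then (1 : ℝ) else 0) * Fb X τ m V T b else 0) := by
  classical
  -- fibre the `b`-sum over `v = red_d b`
  have hmaps : ∀ b ∈ Bbox T, redVec d b ∈ resVecs d := fun b _ => redVec_mem hd b
  rw [← sum_fiberwise_of_maps_to hmaps]
  refine sum_congr rfl fun v hv => ?_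
  rw [mul_sum, sum_filter]
  refine sum_congr rfl fun b _ => ?_
  -- `red_d b = v ↔ d ∣ b − v` for `v ∈ resVecs d`
  have hiff : redVec d b = v ↔ DvdVec (d : ℤ) (b - v) := by
    constructor
    · rintro rfl; exact dvdVec_sub_redVec d b
    · intro h
      refine eq_of_dvdVec_sub (redVec_mem hd b) hv ?_
      have h1 := dvdVec_sub_redVec d b
      have e1 : redVec d b - v = -(b - redVec d b) + (b - v) := by abel
      rw [e1]; exact dvdVec_add (dvdVec_neg h1) h
  by_cases hred : redVec d b = v
  · have hdv : DvdVec (d : ℤ) (b - v) := hiff.mp hred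
    rw [if_pos hred]
    by_cases hW : Wab X η a b
    · by_cases hc : (imulVec a b).1 ≡ a₀ [ZMOD d] ∧ (imulVec a b).2.1 ≡ b₀ [ZMOD d]
      · rw [if_pos ⟨hW, hc⟩, if_pos ((cls_imulVec_iff hdv a₀ b₀).mp hc), if_pos hW, if_pos hdv]; ring
      · rw [if_neg (fun h => hc h.2), if_neg (fun h => hc ((cls_imulVec_iff hdv a₀ b₀).mpr h)), zero_mul]
    · rw [if_neg (fun h => hW h.1), if_neg hW, mul_zero]
  · rw [if_neg hred]
    have hdv : ¬ DvdVec (d : ℤ) (b - v) := fun h => hred (hiff.mpr h)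
    by_cases hW : Wab X η a b
    · rw [if_pos hW, if_neg hdv, zero_mul, mul_zero]
    · rw [if_neg hW, mul_zero]

open scoped Classical in
/-- **Stub E4 `stub_classMainCauchy` of crux `HeathBrownMorozUniform` (line `unit-split-positivity`), PROVED.**
`|M_V^{cl}| ≤ (#Abox)^{1/2} ∑_{v ∈ [0,d)³} S(v)^{1/2}`, `S(v) = ∑_{α̂ prim} (∑_β̂ [W(α̂β̂)][β̂ ≡ v (d)] F_β)²`
(re-indexing by generators, residue split of `β̂`, `|c_α| ≤ 1`, `c_α = 0` off primitive `α̂`, the class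
indicator `≤ 1`, Cauchy–Schwarz). [cite: HeathBrownMoroz2004, Proposition 4.2] [cite: HeathBrownActa2001, §11 p. 68] -/
theorem stub_classMainCauchy :
  ∀ (X η τ V T : ℝ) (k : ℕ) (m : Fin k → ℕ) (c : Ideal (𝓞 K) → ℝ) (d a₀ b₀ : ℕ),
    0 < X → η ≤ 1 → 0 < T → T ^ 3 = V → CSupport X τ c → 0 < d →
      |∑ xy ∈ (box X η).filter (fun xy => xy.1 ≡ a₀ [MOD d] ∧ xy.2 ≡ b₀ [MOD d]), Hprim X τ m V T c xy| ≤
        Real.sqrt (#(Abox X T)) *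
          ∑ v ∈ Finset.Ico (0 : ℤ) d ×ˢ (Finset.Ico (0 : ℤ) d ×ˢ Finset.Ico (0 : ℤ) d),
            Real.sqrt (∑ a ∈ (Abox X T).filter IsPrimitiveVec,
              (∑ b ∈ Bbox T, if Wab X η a b then
                  (if DvdVec (d : ℤ) (b - v) then (1 : ℝ) else 0) * Fb X τ m V T b else 0) ^ 2) := by
  classical
  intro X η τ V T k m c d a₀ b₀ hX hη1 hT hTV hc hd
  rw [classMain_eq_sum_cA (τ := τ) (m := m) (c := c) (d := d) (a₀ := a₀) (b₀ := b₀) hX hη1 hT hTV]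
  -- abbreviations
  set I : (ℤ × ℤ × ℤ) → (ℤ × ℤ × ℤ) → ℝ := fun v a =>
    ∑ b ∈ Bbox T, (if Wab X η a b then (if DvdVec (d : ℤ) (b - v) then (1 : ℝ) else 0) * Fb X τ m V T b else 0)
    with hI
  set χ : (ℤ × ℤ × ℤ) → (ℤ × ℤ × ℤ) → ℝ := fun v a =>
    if ((imulVec a v).1 ≡ a₀ [ZMOD d] ∧ (imulVec a v).2.1 ≡ b₀ [ZMOD d]) then (1 : ℝ) else 0 with hχ
  have hsplit : ∀ a, ∑ b ∈ Bbox T, (if Wab X η a b ∧ ((imulVec a b).1 ≡ a₀ [ZMOD d] ∧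
      (imulVec a b).2.1 ≡ b₀ [ZMOD d]) then Fb X τ m V T b else 0) = ∑ v ∈ resVecs d, χ v a * I v a := by
    intro a
    rw [inner_cls_eq_sum_resVecs (X := X) (η := η) (τ := τ) (m := m) (V := V) (T := T) (a₀ := a₀) (b₀ := b₀) hd a]
  simp_rw [hsplit]
  -- `|∑_a c_a ∑_v χ I| ≤ ∑_v ∑_{a prim} |I v a|`
  set P := (Abox X T).filter IsPrimitiveVec with hP
  have hχ1 : ∀ v a, |χ v a| ≤ 1 := fun v a => by
    simp only [hχ]; split_ifs <;> simp
  have hc1 : ∀ a, |cA c a| ≤ 1 := fun a => by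
    simp only [cA]
    split_ifs
    · rcases hc.1 (Ideal.span {coordElt a}) with h | h <;> rw [h] <;> norm_num
    · simp
  have h1 : |∑ a ∈ Abox X T, cA c a * ∑ v ∈ resVecs d, χ v a * I v a| ≤ ∑ v ∈ resVecs d, ∑ a ∈ P, |I v a| := by
    calc |∑ a ∈ Abox X T, cA c a * ∑ v ∈ resVecs d, χ v a * I v a|
        = |∑ a ∈ P, cA c a * ∑ v ∈ resVecs d, χ v a * I v a| := by
          congr 1
          rw [hP, sum_filter]
          refine sum_congr rfl fun a _ => ?_
          by_cases ha : IsPrimitiveVec a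
          · rw [if_pos ha]
          · rw [if_neg ha]; simp [cA, ha]
      _ ≤ ∑ a ∈ P, |cA c a * ∑ v ∈ resVecs d, χ v a * I v a| := abs_sum_le_sum_abs _ _
      _ ≤ ∑ a ∈ P, ∑ v ∈ resVecs d, |I v a| := by
          refine sum_le_sum fun a _ => ?_
          rw [abs_mul]
          calc |cA c a| * |∑ v ∈ resVecs d, χ v a * I v a| ≤ 1 * ∑ v ∈ resVecs d, |χ v a * I v a| :=
                mul_le_mul (hc1 a) (abs_sum_le_sum_abs _ _) (abs_nonneg _) zero_le_one
            _ ≤ ∑ v ∈ resVecs d, |I v a| := by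
                rw [one_mul]
                refine sum_le_sum fun v _ => ?_
                rw [abs_mul]
                calc |χ v a| * |I v a| ≤ 1 * |I v a| := mul_le_mul_of_nonneg_right (hχ1 v a) (abs_nonneg _)
                  _ = |I v a| := one_mul _
      _ = ∑ v ∈ resVecs d, ∑ a ∈ P, |I v a| := sum_comm
  refine h1.trans ?_
  -- Cauchy–Schwarz in `a` for each `v`
  rw [show (Finset.Ico (0 : ℤ) d ×ˢ (Finset.Ico (0 : ℤ) d ×ˢ Finset.Ico (0 : ℤ) d)) = resVecs d from rfl, mul_sum]
  refine sum_le_sum fun v _ => ?_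
  have h3 := Real.sum_mul_le_sqrt_mul_sqrt P (fun a => |I v a|) (fun _ => (1 : ℝ))
  simp only [sq_abs, one_pow, sum_const, nsmul_eq_mul, mul_one] at h3
  refine h3.trans ?_
  rw [mul_comm]
  gcongr
  rw [hP]; exact filter_subset _ _

end Summit.Parity.GeneralizedHardyLittlewood.Theorems.GoldbachHeathBrownDispersionHeathBrownMorozUniform

end
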